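import Mathlib
import Summits.Ventures.PercRepro2.V2SP
import Summits.Ventures.PercRepro2.Tail2D
import Summits.Ventures.PercRepro2.Tail2DSP
import Summits.Ventures.PercRepro2.Tail2DExchange
import Summits.Ventures.PercRepro2.Tail2DCount

/-!
# The three-point step of the two-dimensional tail calculus (seat mine-b, cell pub-perc-repro2)

Parallel composition of a network `X` with a network `Y` of max-flow `1` (the law of `(r_Y, b_Y)` lives on
the three points `(0,0)`, `(1,0)`, `(0,1)` with weights `t₀, s₁, s₀`) replaces the tail `T` of `X` by
`T'(a, b) = t₀ · T(a, b) + s₁ · T(a - 1, b) + s₀ · T(a, b - 1)`  (`tconv`).  We prove that for EVERY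
M♮-concave tail `T` (`IsMTail`, Tail2D.lean) and ANY weights `t₀ ≥ 0`, `s₁, s₀ > 0` the tail `T'` is
again M♮-concave with top level `L + 1` (`tconv_isMTail`).  Unlike the bundle step no log-concavity of
the weights is needed: each of the three exchange inequalities of `T'` is a quadratic form in
`(t₀, s₁, s₀)` whose six coefficients are signed — four of them are cone-monotonicity instances of the
difference ratios of `T` (Tail2DExchange.lean), the two others are sums of two balanced-pair brackets
of which only one is signed, closed by the elementary `two_bracket` lemma.

On the configuration cubes: `cnt_par` (the counting tail of a parallel composition is the fibre sum of
the counting tail of the first factor over the configurations of the second), `cnt_par_flow1` (for a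
second factor of max-flow `≤ 1` this is `tconv`), and the class `Good` of series–parallel patterns —
free edges, series compositions, parallel compositions with a factor of max-flow `1` — whose counting
tails are all M♮-concave (`Good.isMTail`), extending `cnt_isMTail` (Tail2DCount.lean) beyond the
bundle-parallel terms.
-/

open Finset

namespace Summit.Ventures.PercRepro2.Tail2D

/-- **the two-bracket lemma**: a signed bracket `a - b ≤ 0` absorbs an unsigned one `c - d` as soon as
`c ≤ b` and the cross products satisfy `a c ≤ b d`. -/
lemma two_bracket {a b c d : ℝ} (ha : 0 ≤ a) (hc : 0 ≤ c) (hd : 0 ≤ d) (hab : a ≤ b) (hcb : c ≤ b)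
    (hacbd : a * c ≤ b * d) : a - b + (c - d) ≤ 0 := by
  by_cases hb : b = 0
  · subst hb
    have ha0 : a = 0 := le_antisymm hab ha
    have hc0 : c = 0 := le_antisymm hcb hc
    subst ha0; subst hc0
    linarith
  · have hbpos : 0 < b := lt_of_le_of_ne (le_trans ha hab) (Ne.symm hb)
    have h2 : 0 ≤ (b - a) * (b - c) := mul_nonneg (sub_nonneg.2 hab) (sub_nonneg.2 hcb)
    have key : b * (a - b + (c - d)) ≤ 0 := by nlinarith [h2, hacbd]
    by_contra hX
    have hX' : 0 < a - b + (c - d) := lt_of_not_ge hX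
    have := mul_pos hbpos hX'
    linarith

/-- the three-point convolution of a tail: the tail of the parallel composition with a network of
max-flow `1` whose law has weights `t₀` at `(0,0)`, `s₁` at `(1,0)` and `s₀` at `(0,1)`. -/
noncomputable def tconv (t₀ s₁ s₀ : ℝ) (T : ℤ → ℤ → ℝ) (a b : ℤ) : ℝ :=
  t₀ * T a b + s₁ * T (a - 1) b + s₀ * T a (b - 1)

section ThreePoint

variable {T : ℤ → ℤ → ℝ} {L : ℤ} (hT : IsMTail T L) {t₀ s₁ s₀ : ℝ}

include hT

/-- the skew inequality `m2` of the three-point convolution, for non-negative weights -/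
lemma tconv_m2 (ht₀ : 0 ≤ t₀) (hs₁ : 0 ≤ s₁) (hs₀ : 0 ≤ s₀) (a b : ℤ) :
    tconv t₀ s₁ s₀ T (a + 2) (b - 1) * tconv t₀ s₁ s₀ T a b
      ≤ tconv t₀ s₁ s₀ T (a + 1) b * tconv t₀ s₁ s₀ T (a + 1) (b - 1) := by
  -- the six coefficients
  have hα : T (a + 2) (b - 1) * T a b ≤ T (a + 1) b * T (a + 1) (b - 1) := hT.m2 a b
  have hβ : T (a + 1) (b - 1) * T (a - 1) b ≤ T a b * T a (b - 1) := by
    have := hT.m2 (a - 1) b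
    rwa [show a - 1 + 2 = a + 1 by ring, show a - 1 + 1 = a by ring] at this
  have hγ : T (a + 2) (b - 2) * T a (b - 1) ≤ T (a + 1) (b - 1) * T (a + 1) (b - 2) := by
    have := hT.m2 a (b - 1)
    rwa [show b - 1 - 1 = b - 2 by ring] at this
  have hδ : T (a + 2) (b - 1) * T (a - 1) b ≤ T a (b - 1) * T (a + 1) b := by
    have := hT.dw_cone (a := a - 1) (b := b) (a' := a + 1) (b' := b) (by omega) le_rfl
    rwa [show a + 1 + 1 = a + 2 by ring, show a - 1 + 1 = a by ring] at this
  have hζ : T (a + 2) (b - 2) * T (a - 1) b ≤ T a b * T (a + 1) (b - 2) := by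
    have := hT.m2_iter (a - 1) b (m := 0) (m' := 2) (by norm_num)
    rwa [show a - 1 + 1 + 2 = a + 2 by ring, show a - 1 + 0 = a - 1 by ring, show b - 0 = b by ring,
      show a - 1 + 1 + 0 = a by ring, show a - 1 + 2 = a + 1 by ring] at this
  -- the mixed coefficient: two brackets, one signed
  have hε : T (a + 2) (b - 2) * T a b - T (a + 1) (b - 1) * T (a + 1) (b - 1)
      + (T (a + 2) (b - 1) * T a (b - 1) - T (a + 1) b * T (a + 1) (b - 2)) ≤ 0 := by
    apply two_bracket (mul_nonneg (hT.nonneg _ _) (hT.nonneg _ _)) (mul_nonneg (hT.nonneg _ _) (hT.nonneg _ _))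
      (mul_nonneg (hT.nonneg _ _) (hT.nonneg _ _))
    · -- log-concavity along the anti-diagonal at (a + 1, b - 1)
      have := hT.antidiag (a + 1) (b - 1)
      rw [show a + 1 + 1 = a + 2 by ring, show b - 1 - 1 = b - 2 by ring, show a + 1 - 1 = a by ring,
        show b - 1 + 1 = b by ring] at this
      linarith [this, mul_comm (T (a + 2) (b - 2)) (T a b)]
    · -- log-concavity along the row through (a + 1, b - 1)
      exact hT.row a (b - 1)
    · -- the product of m2 at (a, b) and m2 at (a, b - 1)
      have h1 := hT.m2 a b
      have h2 := hT.m2 a (b - 1)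
      rw [show b - 1 - 1 = b - 2 by ring] at h2
      have := mul_le_mul h1 h2 (mul_nonneg (hT.nonneg _ _) (hT.nonneg _ _))
        (mul_nonneg (hT.nonneg _ _) (hT.nonneg _ _))
      nlinarith [this]
  simp only [tconv, show a + 2 - 1 = a + 1 by ring, show b - 1 - 1 = b - 2 by ring, show a + 1 - 1 = a by ring]
  nlinarith [mul_nonneg (mul_nonneg ht₀ ht₀) (sub_nonneg.2 hα), mul_nonneg (mul_nonneg hs₁ hs₁) (sub_nonneg.2 hβ),
    mul_nonneg (mul_nonneg hs₀ hs₀) (sub_nonneg.2 hγ), mul_nonneg (mul_nonneg ht₀ hs₁) (sub_nonneg.2 hδ),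
    mul_nonneg (mul_nonneg hs₁ hs₀) (sub_nonneg.2 hζ), mul_nonneg (mul_nonneg ht₀ hs₀) (neg_nonneg.2 hε)]

/-- the log-submodularity `m1` of the three-point convolution, for non-negative weights -/
lemma tconv_m1 (ht₀ : 0 ≤ t₀) (hs₁ : 0 ≤ s₁) (hs₀ : 0 ≤ s₀) (a b : ℤ) :
    tconv t₀ s₁ s₀ T (a + 1) (b + 1) * tconv t₀ s₁ s₀ T a b
      ≤ tconv t₀ s₁ s₀ T (a + 1) b * tconv t₀ s₁ s₀ T a (b + 1) := by
  have hα : T (a + 1) (b + 1) * T a b ≤ T (a + 1) b * T a (b + 1) := hT.m1 a b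
  have hβ : T a (b + 1) * T (a - 1) b ≤ T a b * T (a - 1) (b + 1) := by
    have := hT.m1 (a - 1) b
    rwa [show a - 1 + 1 = a by ring] at this
  have hγ : T (a + 1) b * T a (b - 1) ≤ T (a + 1) (b - 1) * T a b := by
    have := hT.m1 a (b - 1)
    rwa [show b - 1 + 1 = b by ring] at this
  have hδ : T (a + 1) (b + 1) * T (a - 1) b ≤ T (a - 1) (b + 1) * T (a + 1) b := by
    have := hT.d2_e1 (a - 1) b 2
    rwa [show a - 1 + (2 : ℕ) = a + 1 by push_cast; ring] at this
  have hε : T (a + 1) (b + 1) * T a (b - 1) ≤ T (a + 1) (b - 1) * T a (b + 1) := by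
    have := hT.d1_e2 a (b - 1) 2
    rwa [show b - 1 + (2 : ℕ) = b + 1 by push_cast; ring] at this
  have hζ : T a (b + 1) * T a (b - 1) - T a b * T a b
      + (T (a + 1) b * T (a - 1) b - T (a + 1) (b - 1) * T (a - 1) (b + 1)) ≤ 0 := by
    apply two_bracket (mul_nonneg (hT.nonneg _ _) (hT.nonneg _ _)) (mul_nonneg (hT.nonneg _ _) (hT.nonneg _ _))
      (mul_nonneg (hT.nonneg _ _) (hT.nonneg _ _))
    · have := hT.col a (b - 1)
      rw [show b - 1 + 2 = b + 1 by ring, show b - 1 + 1 = b by ring] at this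
      exact this
    · have := hT.row (a - 1) b
      rw [show a - 1 + 2 = a + 1 by ring, show a - 1 + 1 = a by ring] at this
      exact this
    · have h1 := hT.m1 a (b - 1)
      rw [show b - 1 + 1 = b by ring] at h1
      have h2 := hT.m1 (a - 1) b
      rw [show a - 1 + 1 = a by ring] at h2
      have := mul_le_mul h1 h2 (mul_nonneg (hT.nonneg _ _) (hT.nonneg _ _))
        (mul_nonneg (hT.nonneg _ _) (hT.nonneg _ _))
      nlinarith [this]
  simp only [tconv, show a + 1 - 1 = a by ring, show b + 1 - 1 = b by ring]
  nlinarith [mul_nonneg (mul_nonneg ht₀ ht₀) (sub_nonneg.2 hα), mul_nonneg (mul_nonneg hs₁ hs₁) (sub_nonneg.2 hβ),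
    mul_nonneg (mul_nonneg hs₀ hs₀) (sub_nonneg.2 hγ), mul_nonneg (mul_nonneg ht₀ hs₁) (sub_nonneg.2 hδ),
    mul_nonneg (mul_nonneg ht₀ hs₀) (sub_nonneg.2 hε), mul_nonneg (mul_nonneg hs₁ hs₀) (neg_nonneg.2 hζ)]

/-- **the three-point step**: the three-point convolution of an M♮-concave tail with any weights
`t₀ ≥ 0`, `s₁ > 0`, `s₀ > 0` is an M♮-concave tail with top level `L + 1`. -/
theorem tconv_isMTail (ht₀ : 0 ≤ t₀) (hs₁ : 0 < s₁) (hs₀ : 0 < s₀) :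
    IsMTail (tconv t₀ s₁ s₀ T) (L + 1) where
  L_nonneg := by have := hT.L_nonneg; omega
  clip₁ := by
    intro a b h; simp only [tconv]
    rw [hT.clip₁ a b h, hT.clip₁ (a - 1) b (by omega), hT.clip₁ (0 - 1) b (by omega), hT.clip₁ a (b - 1) h]
  clip₂ := by
    intro a b h; simp only [tconv]
    rw [hT.clip₂ a b h, hT.clip₂ (a - 1) b h, hT.clip₂ a (b - 1) (by omega), hT.clip₂ a (0 - 1) (by omega)]
  pos := by
    intro a b h; simp only [tconv]
    have hL := hT.L_nonneg
    have h1 : 0 ≤ t₀ * T a b := mul_nonneg ht₀ (hT.nonneg _ _)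
    have h2 : 0 ≤ s₁ * T (a - 1) b := mul_nonneg hs₁.le (hT.nonneg _ _)
    have h3 : 0 ≤ s₀ * T a (b - 1) := mul_nonneg hs₀.le (hT.nonneg _ _)
    by_cases hab : a ≤ 0 ∧ 1 ≤ b
    · have : 0 < T a (b - 1) := hT.pos a (b - 1) (by omega)
      have := mul_pos hs₀ this
      linarith
    · have : 0 < T (a - 1) b := hT.pos (a - 1) b (by omega)
      have := mul_pos hs₁ this
      linarith
  zero := by
    intro a b h; simp only [tconv]
    have hL := hT.L_nonneg
    rw [hT.zero a b (by omega), hT.zero (a - 1) b (by omega), hT.zero a (b - 1) (by omega)]; ring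
  anti₁ := by
    intro a b; simp only [tconv]
    have h1 := hT.anti₁ a b
    have h2 := hT.anti₁ (a - 1) b
    have h3 := hT.anti₁ a (b - 1)
    rw [show a - 1 + 1 = a by ring] at h2
    rw [show a + 1 - 1 = a by ring]
    nlinarith [mul_le_mul_of_nonneg_left h1 ht₀, mul_le_mul_of_nonneg_left h2 hs₁.le,
      mul_le_mul_of_nonneg_left h3 hs₀.le]
  anti₂ := by
    intro a b; simp only [tconv]
    have h1 := hT.anti₂ a b
    have h2 := hT.anti₂ (a - 1) b
    have h3 := hT.anti₂ a (b - 1)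
    rw [show b - 1 + 1 = b by ring] at h3
    rw [show b + 1 - 1 = b by ring]
    nlinarith [mul_le_mul_of_nonneg_left h1 ht₀, mul_le_mul_of_nonneg_left h2 hs₁.le,
      mul_le_mul_of_nonneg_left h3 hs₀.le]
  m1 := tconv_m1 hT ht₀ hs₁.le hs₀.le
  m2 := tconv_m2 hT ht₀ hs₁.le hs₀.le
  m4 := by
    intro a b
    -- the colour swap turns `m4` into `m2` of the swapped convolution
    have h := tconv_m2 hT.swap ht₀ hs₀.le hs₁.le b a
    convert h using 2 <;> simp only [tconv] <;> ring

end ThreePoint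

section Counting

open V2Closure

/-- the counting tail of a parallel composition is the fibre sum, over the configurations of the second
factor, of the counting tail of the first factor shifted by the flows of the fibre -/
theorem cnt_par (X Y : V2Closure.SP) (a b : ℤ) :
    cnt (.par X Y) a b = ∑ y : Y.Conf, cnt X (a - Y.rLab y) (b - Y.bLab y) := by
  unfold cnt
  show (∑ p : X.Conf × Y.Conf, if a ≤ ((X.rLab p.1 + Y.rLab p.2 : ℕ) : ℤ)
      ∧ b ≤ ((X.bLab p.1 + Y.bLab p.2 : ℕ) : ℤ) then (1 : ℝ) else 0) = _
  rw [Fintype.sum_prod_type_right]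
  refine Finset.sum_congr rfl (fun y _ => ?_)
  refine Finset.sum_congr rfl (fun x _ => ?_)
  have e : (a ≤ ((X.rLab x + Y.rLab y : ℕ) : ℤ) ∧ b ≤ ((X.bLab x + Y.bLab y : ℕ) : ℤ))
      ↔ (a - (Y.rLab y : ℤ) ≤ (X.rLab x : ℤ) ∧ b - (Y.bLab y : ℤ) ≤ (X.bLab x : ℤ)) := by
    push_cast; omega
  simp only [e]

/-- the counting tail of a series composition is the product of the counting tails -/
theorem cnt_ser (X Y : V2Closure.SP) (a b : ℤ) : cnt (.ser X Y) a b = cnt X a b * cnt Y a b := by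
  unfold cnt
  rw [Finset.sum_mul_sum, ← Fintype.sum_prod_type']
  refine Finset.sum_congr rfl (fun p _ => ?_)
  simp only [SP.rLab, SP.bLab, serR, serB, Nat.cast_min, le_min_iff]
  split_ifs <;> simp_all

/-- the number of configurations of `Y` with flows exactly `(i, j)` -/
def flowCount (Y : V2Closure.SP) (i j : ℕ) : ℕ :=
  (Finset.univ.filter (fun y : Y.Conf => Y.rLab y = i ∧ Y.bLab y = j)).card

/-- `Y` has max-flow at most one: every configuration has `r + b ≤ 1` -/
def FlowLeOne (Y : V2Closure.SP) : Prop := ∀ y : Y.Conf, Y.rLab y + Y.bLab y ≤ 1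

/-- **parallel composition with a factor of max-flow `≤ 1` is the three-point convolution** of the
counting tail, with the weights `flowCount Y 0 0`, `flowCount Y 1 0`, `flowCount Y 0 1` -/
theorem cnt_par_flow1 (X Y : V2Closure.SP) (hY : FlowLeOne Y) (a b : ℤ) :
    cnt (.par X Y) a b
      = tconv (flowCount Y 0 0) (flowCount Y 1 0) (flowCount Y 0 1) (cnt X) a b := by
  rw [cnt_par]
  have e : ∀ y : Y.Conf, cnt X (a - Y.rLab y) (b - Y.bLab y)
      = (if Y.rLab y = 0 ∧ Y.bLab y = 0 then cnt X a b else 0)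
        + (if Y.rLab y = 1 ∧ Y.bLab y = 0 then cnt X (a - 1) b else 0)
        + (if Y.rLab y = 0 ∧ Y.bLab y = 1 then cnt X a (b - 1) else 0) := by
    intro y
    have hy := hY y
    rcases (show (Y.rLab y = 0 ∧ Y.bLab y = 0) ∨ (Y.rLab y = 1 ∧ Y.bLab y = 0) ∨ (Y.rLab y = 0 ∧ Y.bLab y = 1)
      by omega) with h | h | h
    · rw [h.1, h.2]; simp
    · rw [h.1, h.2]; simp
    · rw [h.1, h.2]; simp
  rw [Finset.sum_congr rfl (fun y _ => e y), Finset.sum_add_distrib, Finset.sum_add_distrib]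
  simp only [Finset.sum_ite, Finset.sum_const_zero, add_zero, Finset.sum_const, nsmul_eq_mul]
  unfold tconv flowCount
  ring

/-- a configuration of `Y` with flows `(1, 0)` exists iff `flowCount Y 1 0 > 0` -/
lemma flowCount_pos {Y : V2Closure.SP} {i j : ℕ} (h : ∃ y : Y.Conf, Y.rLab y = i ∧ Y.bLab y = j) :
    (0 : ℝ) < flowCount Y i j := by
  unfold flowCount
  obtain ⟨y, hy⟩ := h
  have : 0 < (Finset.univ.filter (fun y : Y.Conf => Y.rLab y = i ∧ Y.bLab y = j)).card :=
    Finset.card_pos.2 ⟨y, by simp [hy]⟩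
  exact_mod_cast this

/-- **the three-point step on the configuration cubes**: if the counting tail of `X` is M♮-concave
and `Y` has max-flow `1` (every configuration has `r + b ≤ 1`, and the flows `(1, 0)` and `(0, 1)`
both occur), the counting tail of `X ∗ Y` is M♮-concave with top level `L + 1` -/
theorem cnt_par_flow1_isMTail {X : V2Closure.SP} {L : ℤ} (hX : IsMTail (cnt X) L) (Y : V2Closure.SP)
    (hY : FlowLeOne Y) (h10 : ∃ y : Y.Conf, Y.rLab y = 1 ∧ Y.bLab y = 0)
    (h01 : ∃ y : Y.Conf, Y.rLab y = 0 ∧ Y.bLab y = 1) : IsMTail (cnt (.par X Y)) (L + 1) := by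
  have e : cnt (.par X Y) = tconv (flowCount Y 0 0) (flowCount Y 1 0) (flowCount Y 0 1) (cnt X) :=
    funext (fun a => funext (fun b => cnt_par_flow1 X Y hY a b))
  rw [e]
  exact tconv_isMTail hX (by positivity) (flowCount_pos h10) (flowCount_pos h01)

/-- **the class `Good`** of series–parallel patterns with an M♮-concave counting tail of top level `L`:
free edges, series compositions, and parallel compositions whose second factor has max-flow exactly
one (so in particular bundle-parallel terms, and parallel compositions with any series chain of
free edges, with `(e ∗ e) ∧ e`, …) -/
inductive Good : V2Closure.SP → ℤ → Prop
  | free : Good .free 1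
  | ser {s t : V2Closure.SP} {L M : ℤ} : Good s L → Good t M → Good (.ser s t) (min L M)
  | par {s : V2Closure.SP} {L : ℤ} (Y : V2Closure.SP) : Good s L → FlowLeOne Y →
      (∃ y : Y.Conf, Y.rLab y = 1 ∧ Y.bLab y = 0) → (∃ y : Y.Conf, Y.rLab y = 0 ∧ Y.bLab y = 1) →
      Good (.par s Y) (L + 1)

/-- the counting tail of a free edge is M♮-concave of level `1` -/
theorem cnt_free_isMTail : IsMTail (cnt .free) 1 := cnt_isMTail BSP.edge

/-- **(TAIL-M♮) on the configuration cubes of the class `Good`** -/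
theorem Good.isMTail {s : V2Closure.SP} {L : ℤ} (h : Good s L) : IsMTail (cnt s) L := by
  induction h with
  | free => exact cnt_free_isMTail
  | @ser s t L M _ _ ihs iht =>
      have e : cnt (.ser s t) = fun a b => cnt s a b * cnt t a b :=
        funext (fun a => funext (fun b => cnt_ser s t a b))
      rw [e]; exact IsMTail.mul ihs iht
  | par Y _ hY h10 h01 ih => exact cnt_par_flow1_isMTail ih Y hY h10 h01

/-- a free edge has max-flow `≤ 1` -/
theorem flowLeOne_free : FlowLeOne .free := by
  intro y; cases y <;> simp [SP.rLab, SP.bLab]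

/-- a series composition with a factor of max-flow `≤ 1` has max-flow `≤ 1` -/
theorem flowLeOne_ser_left {Y : V2Closure.SP} (hY : FlowLeOne Y) (Z : V2Closure.SP) :
    FlowLeOne (.ser Y Z) := by
  intro p
  have := hY p.1
  show min (Y.rLab p.1) (Z.rLab p.2) + min (Y.bLab p.1) (Z.bLab p.2) ≤ 1
  omega

/-- a series composition with a factor of max-flow `≤ 1` has max-flow `≤ 1` (second factor) -/
theorem flowLeOne_ser_right (Y : V2Closure.SP) {Z : V2Closure.SP} (hZ : FlowLeOne Z) :
    FlowLeOne (.ser Y Z) := by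
  intro p
  have := hZ p.2
  show min (Y.rLab p.1) (Z.rLab p.2) + min (Y.bLab p.1) (Z.bLab p.2) ≤ 1
  omega

/-- every bundle-parallel term lies in `Good` (with its level) -/
theorem BSP.good : ∀ t : BSP, Good t.toSP t.level
  | .edge => Good.free
  | .ser s t => by
      show Good (.ser s.toSP t.toSP) (min s.level t.level)
      exact Good.ser (BSP.good s) (BSP.good t)
  | .pe s => by
      show Good (.par s.toSP .free) (s.level + 1)
      exact Good.par .free (BSP.good s) flowLeOne_free ⟨false, by simp [SP.rLab, SP.bLab]⟩
        ⟨true, by simp [SP.rLab, SP.bLab]⟩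

/-- (TAIL-LC) on the configuration cubes of the class `Good` -/
theorem Good.antidiag {s : V2Closure.SP} {L : ℤ} (h : Good s L) (a b : ℤ) :
    cnt s (a + 1) (b - 1) * cnt s (a - 1) (b + 1) ≤ cnt s a b * cnt s a b :=
  h.isMTail.antidiag a b

/-- BAL on the configuration cubes of a colour-symmetric pattern of the class `Good` -/
theorem Good.bal {s : V2Closure.SP} {L : ℤ} (h : Good s L) (hsym : ∀ x y, cnt s x y = cnt s y x)
    {a b : ℤ} (hab : a ≤ b) : cnt s (a - 1) (b + 1) ≤ cnt s a b :=
  h.isMTail.bal hsym hab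

end Counting

end Summit.Ventures.PercRepro2.Tail2D
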